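import Summits.ResolutionOfSingularities.ResolutionOfSingularities.Theorems.FrobeniusLadderFRationalResolutionRegularPointRegularCone
import Summits.ResolutionOfSingularities.ResolutionOfSingularities.Theorems.FrobeniusLadderFRationalResolutionRegularConeRegularPoint
import HarnessLib

/-!
# Crux `FrobeniusLadder.FRationalResolution` (stmt-ResolutionOfSingularities-15317), line `redirect`,
# stub `stub_diagonalizableQuotientResolution` — **round 0 along a stratum: a singular «fixed» point of a log regular
# chart is singular at EVERY point of its stratum** (design C3 = the rank-2 stratum layer of the non-isolated case,
# memo MEMO-15317-leafhand2-g10 §2 (L1): the reduced singular locus of the base chart near `𝔭` is the stratum closure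
# `V(φ(P ∖ 0))`, so the intrinsic centre `𝓘_{Sing}` of round 0 read on the chart is Kato's ideal)

For `φ : P → A` (`P ⊆ ℤⁿ` finitely generated, saturated, spanning; `A` Noetherian) with unit face `0` at `𝔭`
(`φ(P ∖ 0) ⊆ 𝔭`), every prime `𝔮 ⊆ 𝔭` containing Kato's ideal `I(𝔭, φ) = (φ(P ∖ 0))` again has unit face `0` and
THE SAME face fan. By (κ″) `…RegularPointRegularCone.isRegular_ofCone_of_isRegularLocalRing` at `𝔮` and (κ′)
`LogChart.isRegularLocalRing_of_isRegular_ofCone` at `𝔭`, regularity of `A_𝔮` would force regularity of `A_𝔭`: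
* **`not_isRegularLocalRing_of_stratum_of_face_zero`** — `A_𝔭` singular, `φ` log regular at `𝔭` and at `𝔮` ⇒ `A_𝔮`
  singular. No combinatorics of the cone is used. With the landed `…FixedStratum*` bricks this completes the
  ring-level description of the singular locus near a rank-2 stratum point: the stratum (round 0, this file) and,
  after each round, the fixed strata of the charts with `c ≥ 2` (`…FixedStratumBlowupPoints`).

Honest label: generic local algebra toward ONE leaf stub (no stub, crux or summit closed). No definitions, no named
facts, no sorry. [cite: Kato1994, Def. (2.1), (7.3), (10.4)] [cite: Fulton1993Toric, §1.3, §2.1]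
-/

noncomputable section

-- single-problem summit: the doubled namespace component is forced
set_option linter.dupNamespace false

open IsLocalRing Literature.AlgebraicGeometry.Resolution Literature.AlgebraicGeometry.Resolution.LogChart
open Literature.Geometry.PolyhedralFans
open Summit.ResolutionOfSingularities.ResolutionOfSingularities.Theorems.FRationalResolution.RegularPointRegularCone

namespace Summit.ResolutionOfSingularities.ResolutionOfSingularities.Theorems.FRationalResolution.FixedStratumBaseSingular

variable {n : ℕ} {A : Type} [CommRing A] [IsNoetherianRing A] {P : AddSubmonoid (Fin n → ℤ)}
  {φ : Multiplicative P →* A} {𝔭 𝔮 : Ideal A} [𝔭.IsPrime] [𝔮.IsPrime]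

omit [IsNoetherianRing A] [𝔭.IsPrime] [𝔮.IsPrime] in
/-- Along the stratum of a unit-face-`0` point the unit face stays `0`: if `I(𝔭, φ) ⊆ 𝔮` then `φ(P ∖ 0) ⊆ 𝔮`.
[cite: Kato1994, Def. (2.1), (7.3)] -/
theorem face_zero_of_ideal_le (hI : ideal P φ 𝔭 ≤ 𝔮)
    (hface : ∀ p : P, (p : Fin n → ℤ) ≠ 0 → φ (Multiplicative.ofAdd p) ∈ 𝔭) :
    ∀ p : P, (p : Fin n → ℤ) ≠ 0 → φ (Multiplicative.ofAdd p) ∈ 𝔮 :=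
  fun p hp => hI (Ideal.subset_span ⟨p, hface p hp, rfl⟩)

/-- **A singular unit-face-`0` point of a log regular chart is singular along its whole stratum.** See the module
docstring. [cite: Kato1994, Def. (2.1), (7.3), (10.4)] [cite: Fulton1993Toric, §1.3, §2.1] -/
theorem not_isRegularLocalRing_of_stratum_of_face_zero (hP : P.FG)
    (hsat : ∀ (v : Fin n → ℤ) (k : ℕ), 0 < k → k • v ∈ P → v ∈ P)
    (hspan : Submodule.span ℤ (P : Set (Fin n → ℤ)) = ⊤)
    (hI : ideal P φ 𝔭 ≤ 𝔮) (hface : ∀ p : P, (p : Fin n → ℤ) ≠ 0 → φ (Multiplicative.ofAdd p) ∈ 𝔭)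
    (hreg𝔭 : IsLogRegularAt P φ 𝔭) (hreg𝔮 : IsLogRegularAt P φ 𝔮)
    (hsing : ¬ IsRegularLocalRing (Localization.AtPrime 𝔭)) :
    ¬ IsRegularLocalRing (Localization.AtPrime 𝔮) := by
  intro hR
  have hΔ := isRegular_ofCone_of_isRegularLocalRing (φ := φ) hP hsat hspan 𝔮 hreg𝔮
    (face_zero_of_ideal_le hI hface) hR
  exact hsing (isRegularLocalRing_of_isRegular_ofCone hP hsat hspan hreg𝔭 hface hΔ)

/-- **The stratum of a singular unit-face-`0` point lies in the singular locus** (form with the log-regular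
neighbourhood as a hypothesis on all stratum primes below `𝔭`). [cite: Kato1994, Def. (2.1), (7.3), (10.4)] -/
theorem forall_not_isRegularLocalRing_of_stratum (hP : P.FG)
    (hsat : ∀ (v : Fin n → ℤ) (k : ℕ), 0 < k → k • v ∈ P → v ∈ P)
    (hspan : Submodule.span ℤ (P : Set (Fin n → ℤ)) = ⊤)
    (hface : ∀ p : P, (p : Fin n → ℤ) ≠ 0 → φ (Multiplicative.ofAdd p) ∈ 𝔭) (hreg𝔭 : IsLogRegularAt P φ 𝔭)
    (hreg' : ∀ (𝔮' : Ideal A) [𝔮'.IsPrime], 𝔮' ≤ 𝔭 → ideal P φ 𝔭 ≤ 𝔮' → IsLogRegularAt P φ 𝔮')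
    (hsing : ¬ IsRegularLocalRing (Localization.AtPrime 𝔭)) :
    ∀ (𝔮' : Ideal A) [𝔮'.IsPrime], 𝔮' ≤ 𝔭 → ideal P φ 𝔭 ≤ 𝔮' →
      ¬ IsRegularLocalRing (Localization.AtPrime 𝔮') :=
  fun 𝔮' _ hle hI => not_isRegularLocalRing_of_stratum_of_face_zero hP hsat hspan hI hface hreg𝔭 (hreg' 𝔮' hle hI)
    hsing

end Summit.ResolutionOfSingularities.ResolutionOfSingularities.Theorems.FRationalResolution.FixedStratumBaseSingular

end
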